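import Mathlib.RingTheory.PowerSeries.Expand
import Mathlib.RingTheory.PowerSeries.Inverse
import Mathlib.RingTheory.PowerSeries.NoZeroDivisors
import Mathlib.Algebra.BigOperators.NatAntidiagonal
import Mathlib.Order.Interval.Finset.Nat
import Mathlib.Tactic
import HarnessLib

/-!
# Route `EisensteinDepletionAtTwo`, crux `StarGO2Sigma` (stmt-BirchSwinnertonDyer-27046), line `kummer` v7 —
# THE SQUARE CRITERION IN `ℤ⟦q⟧` (K√ `stub_sqrtCriterion`, KERNEL-CHECKED): `P(0) = 1`, `P² ≡ P(q²) (mod 4)` ⟹ `P = R²`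

planner bsd-rank2-p2 GEN 38, PART 11 (evidence for 27046; the lead lands it `--supports 27046`).  This is the `p = 2`,
exponent `½` case of the Dieudonné–Dwork integrality lemma, proved here by an ELEMENTARY division-free route:

1. `P² − P(q²) = 4E` and `P·P⁻¹ = 1` give `Q := P(q²)·P⁻² = 1 + 4B`, `B = −E·P⁻² ∈ qℤ⟦q⟧`.
2. The fixed-point equation `T + T² = B` has a (unique) solution `T ∈ qℤ⟦q⟧` — coefficient recursion
   `t_n = b_n − Σ_{0<i<n} t_i t_{n−i}` WITHOUT division (`fixSeq`); then `S := 1 + 2T` satisfies `S² = 1 + 4B = Q`.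
3. `F := P·S ∈ ℤ⟦q⟧` satisfies `F² = P²Q = P(q²)`; a series with constant term `1` whose square is a series in `q²` is
   itself a series in `q²` (`F(−q)² = F(q)²`, `F(−q) + F(q)` has constant term `2 ≠ 0`, `ℤ⟦q⟧` is a domain), so
   `F = R(q²)` with `R := Σ f_{2n} qⁿ ∈ ℤ⟦q⟧`, and `R(q²)² = P(q²)` gives `R² = P` (compare coefficients at `q^{2n}`).

HONEST FRAMING: pure commutative algebra in `ℤ⟦q⟧`; no elliptic curve, no analytic rank, no BSD.  It discharges the stub
`stub_sqrtCriterion` of the v7 design (HOME/p2/g38/KUMMER-V7-DESIGN.md) verbatim (`sqrtCriterion` below).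
References: B. Dwork, *Norm residue symbol in local number fields* (1958) §1 (Dieudonné–Dwork lemma); S. Lang, *Cyclotomic
Fields I–II*, Ch. 14 §2; folklore.
-/

set_option autoImplicit false
set_option linter.dupNamespace false

noncomputable section

namespace Summit.BirchSwinnertonDyer.BirchSwinnertonDyer.Theorems.DepletionAtTwo.KEta.SqrtCriterion

open PowerSeries Finset

/-! ## §1 The division-free recursion `t_n = b_n − Σ_{0<i<n} t_i t_{n−i}` -/

/-- The coefficients of the solution `T ∈ qℤ⟦q⟧` of `T + T² = B` (for `B ∈ qℤ⟦q⟧`), by strong recursion.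
[folklore] -/
def fixSeq (b : ℕ → ℤ) : ℕ → ℤ
  | n => b n - ∑ i ∈ (Ioo 0 n).attach, fixSeq b i.1 * fixSeq b (n - i.1)
decreasing_by
  all_goals
    have hi := Finset.mem_Ioo.mp i.2
    omega

/-- The recursion, unfolded. [folklore] -/
theorem fixSeq_eq (b : ℕ → ℤ) (n : ℕ) :
    fixSeq b n = b n - ∑ i ∈ Ioo 0 n, fixSeq b i * fixSeq b (n - i) := by
  rw [fixSeq, Finset.sum_attach (Ioo 0 n) (fun i => fixSeq b i * fixSeq b (n - i))]

/-- `t_0 = b_0`. [folklore] -/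
theorem fixSeq_zero (b : ℕ → ℤ) : fixSeq b 0 = b 0 := by
  rw [fixSeq_eq]
  simp

/-- **The fixed point `T + T² = B`** for `B ∈ qℤ⟦q⟧`, with `T ∈ qℤ⟦q⟧`. [folklore] -/
theorem exists_fixedPoint (B : PowerSeries ℤ) (hB : constantCoeff B = 0) :
    ∃ T : PowerSeries ℤ, constantCoeff T = 0 ∧ T + T ^ 2 = B := by
  have ht0 : fixSeq (fun n => coeff n B) 0 = 0 := by
    rw [fixSeq_zero, coeff_zero_eq_constantCoeff_apply, hB]
  refine ⟨PowerSeries.mk (fixSeq fun n => coeff n B), ?_, ?_⟩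
  · rw [← coeff_zero_eq_constantCoeff_apply, coeff_mk, ht0]
  · ext n
    rw [map_add, coeff_mk, sq, coeff_mul,
      Finset.Nat.sum_antidiagonal_eq_sum_range_succ (fun i j => coeff i (PowerSeries.mk (fixSeq fun n => coeff n B)) *
        coeff j (PowerSeries.mk (fixSeq fun n => coeff n B))) n]
    simp only [coeff_mk]
    have hsub : Ioo 0 n ⊆ range n.succ := fun i hi => by
      rw [Finset.mem_Ioo] at hi
      rw [Finset.mem_range]
      omega
    rw [← Finset.sum_subset hsub fun i hi hi' => ?_, fixSeq_eq (fun n => coeff n B) n]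
    · ring
    · rw [Finset.mem_range] at hi
      rw [Finset.mem_Ioo] at hi'
      rcases Nat.eq_zero_or_pos i with h | h
      · rw [h, ht0, zero_mul]
      · have hin : i = n := by omega
        rw [hin, Nat.sub_self, ht0, mul_zero]

/-- **Square roots of `1 + 4B`, `B ∈ qℤ⟦q⟧`, exist in `1 + 2qℤ⟦q⟧`**: `S = 1 + 2T` with `T + T² = B`. [folklore] -/
theorem exists_sqrt_one_add_four_mul (B : PowerSeries ℤ) (hB : constantCoeff B = 0) :
    ∃ S : PowerSeries ℤ, constantCoeff S = 1 ∧ S ^ 2 = 1 + 4 * B := by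
  obtain ⟨T, hT0, hT⟩ := exists_fixedPoint B hB
  refine ⟨1 + 2 * T, by rw [map_add, map_one, map_mul, hT0, mul_zero, add_zero], ?_⟩
  rw [← hT]
  ring

/-! ## §2 Even series: a series with constant term `1` whose square is a series in `q²` is a series in `q²` -/

/-- `P(q²)` is invariant under `q ↦ −q`. [folklore] -/
theorem rescale_neg_one_expand (P : PowerSeries ℤ) :
    rescale (-1) (expand 2 two_ne_zero P) = expand 2 two_ne_zero P := by
  ext n
  rw [coeff_rescale]
  by_cases h : 2 ∣ n
  · rw [(even_iff_two_dvd.mpr h).neg_one_pow, one_mul]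
  · rw [coeff_expand_of_not_dvd 2 two_ne_zero P h, mul_zero]

/-- If `F(0) = 1` and `F² = P(q²)` then every odd coefficient of `F` vanishes. [folklore] -/
theorem coeff_eq_zero_of_sq_eq_expand {F P : PowerSeries ℤ} (hF0 : constantCoeff F = 1)
    (hF : F ^ 2 = expand 2 two_ne_zero P) {n : ℕ} (hn : ¬ 2 ∣ n) : coeff n F = 0 := by
  have hsq : (rescale (-1) F) ^ 2 = F ^ 2 := by
    rw [← map_pow, hF, rescale_neg_one_expand]
  rcases (Commute.all _ _).sq_eq_sq_iff_eq_or_eq_neg.mp hsq with h | h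
  · have hc := congrArg (coeff n) h
    rw [coeff_rescale, (Nat.odd_iff.mpr (Nat.two_dvd_ne_zero.mp hn)).neg_one_pow] at hc
    linarith
  · exfalso
    have hc := congrArg constantCoeff h
    rw [← coeff_zero_eq_constantCoeff_apply, coeff_rescale, pow_zero, one_mul, coeff_zero_eq_constantCoeff_apply,
      map_neg, hF0] at hc
    norm_num at hc

/-- If `F(0) = 1` and `F² = P(q²)` then `F = R(q²)` with `R := Σ f_{2n} qⁿ`. [folklore] -/
theorem expand_evenPart_eq {F P : PowerSeries ℤ} (hF0 : constantCoeff F = 1) (hF : F ^ 2 = expand 2 two_ne_zero P) :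
    expand 2 two_ne_zero (PowerSeries.mk fun n => coeff (2 * n) F) = F := by
  ext m
  rw [coeff_expand]
  split_ifs with h
  · rw [coeff_mk, Nat.mul_div_cancel' h]
  · rw [coeff_eq_zero_of_sq_eq_expand hF0 hF h]

/-! ## §3 The criterion -/

/-- `∀ n, 4 ∣ [qⁿ]E` packages as `E = 4F`. [folklore] -/
theorem exists_eq_four_mul {E : PowerSeries ℤ} (h : ∀ n : ℕ, (4 : ℤ) ∣ coeff n E) :
    ∃ F : PowerSeries ℤ, E = 4 * F := by
  choose g hg using h
  refine ⟨PowerSeries.mk g, PowerSeries.ext fun n => ?_⟩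
  rw [show (4 : PowerSeries ℤ) = C (4 : ℤ) from (map_ofNat C 4).symm, coeff_C_mul, coeff_mk]
  exact hg n

/-- **THE SQUARE CRITERION IN `ℤ⟦q⟧` (K√ of kummer v7 = Dieudonné–Dwork at `p = 2`, exponent `½`)**: an integral
series `P` with `P(0) = 1` and `P² ≡ P(q²) (mod 4)` coefficientwise is the square of an integral series `R` with
`R(0) = 1`.  [cite: LangCyclotomic1990, Ch. 14 §2 (Dwork's lemma)] [folklore] -/
theorem sqrtCriterion (P : PowerSeries ℤ) (h0 : constantCoeff P = 1)
    (h : ∀ n : ℕ, (4 : ℤ) ∣ coeff n (P ^ 2 - expand 2 two_ne_zero P)) :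
    ∃ R : PowerSeries ℤ, constantCoeff R = 1 ∧ R ^ 2 = P := by
  -- (1) `P² − P(q²) = 4E`, `P P⁻¹ = 1`, `B := −E P⁻²`
  obtain ⟨E, hE⟩ := exists_eq_four_mul h
  have hPi : P * invOfUnit P 1 = 1 := mul_invOfUnit P 1 (by rw [h0, Units.val_one])
  have hE0 : constantCoeff E = 0 := by
    have hc := congrArg constantCoeff hE
    rw [map_sub, map_pow, constantCoeff_expand, h0, one_pow, sub_self, map_mul, map_ofNat] at hc
    omega
  have hB0 : constantCoeff (-(E * invOfUnit P 1 ^ 2)) = 0 := by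
    rw [map_neg, map_mul, hE0, zero_mul, neg_zero]
  -- (2) `S² = 1 + 4B`
  obtain ⟨S, hS0, hS⟩ := exists_sqrt_one_add_four_mul _ hB0
  -- (3) `F := P S` has `F² = P(q²)`
  have hF : (P * S) ^ 2 = expand 2 two_ne_zero P := by
    rw [mul_pow, hS]
    linear_combination hE - 4 * E * (1 + P * invOfUnit P 1) * hPi
  have hF0 : constantCoeff (P * S) = 1 := by rw [map_mul, h0, hS0, mul_one]
  -- `F = R(q²)`, `R² = P`
  refine ⟨PowerSeries.mk fun n => coeff (2 * n) (P * S), ?_, ?_⟩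
  · rw [← coeff_zero_eq_constantCoeff_apply, coeff_mk, mul_zero, coeff_zero_eq_constantCoeff_apply, hF0]
  · ext n
    rw [← coeff_expand_mul 2 two_ne_zero (_ ^ 2) n, map_pow, expand_evenPart_eq hF0 hF, hF, coeff_expand_mul]

end Summit.BirchSwinnertonDyer.BirchSwinnertonDyer.Theorems.DepletionAtTwo.KEta.SqrtCriterion

end
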